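import Summits.QuantumFields.BalabanUV.Beta.EriceFlowEnclosureB12AsPrintedTuned

/-!
# Beta / EriceFlowEnclosureB12AsPrintedTunedUpper — the binder «inside the interval the couplings obey (0.20)» of `…B12AsPrintedTuned`
# DISCHARGED from the upper letter (U) by the printed forward determination (0.20); hence Theorem 2's tuned runs are Theorem-3 runs from
# Theorem 2 + (U), and from the three box letters alone (β-flow team, prover 1, unit `b2b-balaban-beta-bflow-p1`, gen 32; ROW AP-I; refines
# `…B12AsPrintedTuned`)

HONEST FRAMING (page 1 of everything the β sub-cell writes): discharging `BetaPertH` makes Bałaban's UV stability UNCONDITIONAL — a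
real constructive-QFT result; it is NOT the continuum limit and NOT the Clay problem.  HONEST DEPENDENCY (cell reorg 2026-08-19,
verbatim): «continuum YM on T⁴ ⇐ BetaPertH ∧ nine spine estimates (0/9 proved); BetaPertH ⇐ (D1) ∧ (D4) ∧ CAP+tail; G-an2-4 gates
asym, D1 and NE2/3/4.»  THIS MODULE DISCHARGES NOTHING of the wall: bookkeeping over the NAMED FIELDS of `B12BetaAsPrinted` ([I] =
[Balaban1987RG1] as typed, p537882 ✓ ∕ v1.1 p539116 ✓) and the β sub-cell's LETTERS (`FlowStep.BetaUpperH` — (U), among socket e3's binders;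
`BetaLowerH` — the located unprinted sign ∕ AF input; `BetaContH`).  HYPOTHESES on an abstract `Setting`; nothing of [I] or of Bałaban's
objects asserted.

THE POINT.  `…B12AsPrintedTuned` carried the binder `hrg : ∀ P, Step.InInterval S.γ P.K (S.cpl P) → FlowStep.RGEqH P.K S.β (S.cpl P)` because
the interface types (0.20) only in its forward-determination form `Definitions.d020` («if 1∕g_k² − β_{k+1}(g₀, …, g_k) > 0 then g_{k+1} is the
positive solution»).  But along a run inside ]0, γ] every prefix is a box history, so the UPPER letter β_{k+1} ≤ b′ on ]0, γ]^{k+1} with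
b′γ² < 1 makes the right side ≥ 1∕γ² − b′ > 0 at every step — and `d020` yields (0.20) (`hrg_of_betaUpperH`).  No sign, no continuity, no
Theorem 2 needed for that step.

WHAT THIS FILE PROVES (0 sorry, 0 def):
§1 `prefixOf_mem_box_of_inInterval`; **`hrg_of_betaUpperH`** (`Definitions S → BetaUpperH b′ γ S.β → b′γ² < 1 → ∀ P, InInterval γ P.K (cpl P) →
   RGEqH P.K S.β (cpl P)`); `betaUpperH_mono`.
§2 **`runHyp_of_theorem2Statement_of_upper`** (`Theorem2Statement S hL` + `Definitions` + (U) on ]0, γu] ⟹ for every m: ∃ γ₁ > 0 ∀ γ ≤ γ₁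
   ∃ g₁ > 0 ∀ g ≤ g₁ ∃ 0 < β ≤ β′ ∀ K ∃ g₀: `RunHyp S ⟨K, m, g₀⟩` ∧ run in ]0, γ] ∧ g_K = g ∧ (0.31) — B16 p. 355's sentence with `hrg`
   discharged; γ₁ = min(γ₀, γu, S.γ, 1∕√(|b′| + 1))); **`theorem2_rate_le_betaPrime510_of_upper`** (+ `Conclusions`: print's bound
   |β_{j+1}| ≤ β′₅₁₀ along the tuned family and **β·ln L ≤ β′₅₁₀**, (0.31)'s upper constant replaced by min(β′ ln L, β′₅₁₀));
   **`runHyp_of_letters`** (`StandingHypotheses ∧ Definitions` + continuity + `0 < b ≤ β_{k+1} ≤ b′` on the boxes ⟹ tuned runs WITH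
   `RunHyp`: `…B12AsPrintedUpper.theorem2Statement_of_letters` then §2 — under the sub-cell's three box letters Theorem 3's printed
   `Conclusions` apply to the tuned family with no further binder).
NOT CLAIMED: (U), the sign letter, continuity, Theorem 2 or any interface field for the construction; `BetaPertH`; continuum; Clay.
-/

namespace Summit.QuantumFields.BalabanUV.Beta.EriceFlowEnclosureB12AsPrintedTunedUpper

open Literature.MathematicalPhysics.QuantumFieldTheory.Balaban1983to89
open Literature.MathematicalPhysics.QuantumFieldTheory.Balaban1983to89.B12BetaAsPrinted
open Literature.MathematicalPhysics.QuantumFieldTheory.Balaban1983to89.B12Sec2to5 (betaPrime510)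
open Literature.MathematicalPhysics.QuantumFieldTheory.Balaban1983to89.FlowStep (prefixOf Box BetaContH BetaLowerH BetaUpperH mem_box)
open Summit.QuantumFields.BalabanUV.Beta.EriceFlowEnclosureB12AsPrintedUpper
open Summit.QuantumFields.BalabanUV.Beta.EriceFlowEnclosureB12AsPrintedTuned

noncomputable section

variable {S : Setting}

/-! ## §1 The binder `hrg` from the UPPER letter (U) and the printed forward determination (0.20) -/

/-- Run prefixes of a run inside ]0, γ] are box histories. [folklore] -/
theorem prefixOf_mem_box_of_inInterval {γ : ℝ} {K : ℕ} {g : ℕ → ℝ} (hI : Step.InInterval γ K g) {k : ℕ} (hk : k ≤ K) :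
    prefixOf g k ∈ Box γ k :=
  mem_box.mpr fun i => hI i ((Nat.le_of_lt_succ i.isLt).trans hk)

/-- **THE BINDER `hrg` OF `…B12AsPrintedTuned` FOLLOWS FROM THE UPPER LETTER (U) ON THE BOXES, FOR γ WITH b′γ² < 1.**  If the printed
`Definitions` hold (only (0.20)'s forward determination `d020` is used) and `β_{k+1} ≤ b′` on the boxes ]0, γ]^{k+1} (`FlowStep.BetaUpperH b′ γ S.β` —
the β sub-cell's letter (U), among socket e3's binders; print gives it on run prefixes of Theorem-3 runs only), then along EVERY run of the
setting inside ]0, γ] the recursion (0.20) holds: at each step 1∕g_k² − β_{k+1}(g₀, …, g_k) ≥ 1∕γ² − b′ > 0, so `d020` determines g_{k+1} as the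
positive solution.  No sign of β, no continuity. [cite: Balaban1987RG1, (0.20) p.256 with Thm 3 p.264] -/
theorem hrg_of_betaUpperH (hD : Definitions S) {b' γ : ℝ} (hγ : 0 < γ) (hup : BetaUpperH b' γ S.β) (hsmall : b' * γ ^ 2 < 1)
    (P : B12.RunParams) (hI : Step.InInterval γ P.K (S.cpl P)) : FlowStep.RGEqH P.K S.β (S.cpl P) := by
  intro k hk
  have hpos : ∀ i, i ≤ k → 0 < S.cpl P i := fun i hi => (hI i (hi.trans hk.le)).1
  have hgk := hI k hk.le
  have hβ : S.β k (prefixOf (S.cpl P) k) ≤ b' := hup k _ (prefixOf_mem_box_of_inInterval hI hk.le)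
  have hγ2 : 0 < γ ^ 2 := by positivity
  have hinv : 1 / γ ^ 2 ≤ 1 / (S.cpl P k) ^ 2 :=
    one_div_le_one_div_of_le (pow_pos hgk.1 2) (pow_le_pow_left₀ hgk.1.le hgk.2 2)
  have hb' : b' < 1 / γ ^ 2 := by rw [lt_div_iff₀ hγ2]; linarith
  have hrhs : 0 < 1 / (S.cpl P k) ^ 2 - S.β k (prefixOf (S.cpl P) k) := by linarith
  obtain ⟨-, heq⟩ := hD.d020 P k hk hpos hrhs
  exact heq

/-- Monotonicity of (U) in γ. [folklore] -/
theorem betaUpperH_mono {b' γ γ' : ℝ} (h : BetaUpperH b' γ' S.β) (hle : γ ≤ γ') : BetaUpperH b' γ S.β :=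
  fun k v hv => h k v (FlowStep.box_mono hle k hv)

/-! ## §2 Theorem 2's tuned runs are Theorem-3 runs, from (U) instead of `hrg` -/

/-- **B16 p. 355's sentence from Theorem 2 + (U) + the printed definitions.**  `Theorem2Statement S hL`, `Definitions S` and the upper
letter `BetaUpperH b′ γu S.β` give, for every m, a γ₁ > 0 such that for every γ ≤ γ₁ (γ ≤ γu, γ ≤ S.γ, b′γ² < 1 built in) and every small g,
constants 0 < β ≤ β′ and at EVERY K a bare coupling g₀ with `RunHyp S ⟨K, m, g₀⟩` (Theorem 3's run hypothesis), g_K = g and (0.31) per step —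
`…B12AsPrintedTuned.runHyp_of_theorem2Statement` with its binder `hrg` DISCHARGED by `hrg_of_betaUpperH` on ]0, γ].
[cite: Balaban1989LargeFieldII, Thm 1 p.355; Balaban1987RG1, Thm 2 (0.31) p.259, (0.20) p.256] -/
theorem runHyp_of_theorem2Statement_of_upper {hL : Odd S.L ∧ 1 < S.L} (h : Theorem2Statement S hL) (hD : Definitions S)
    {b' γu : ℝ} (hγu : 0 < γu) (hup : BetaUpperH b' γu S.β) (hSγ : 0 < S.γ) (m : ℕ) :
    ∃ γ₁ : ℝ, 0 < γ₁ ∧ ∀ γ : ℝ, 0 < γ → γ ≤ γ₁ → ∃ g₁ : ℝ, 0 < g₁ ∧ ∀ g : ℝ, 0 < g → g ≤ g₁ →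
      ∃ β β' : ℝ, 0 < β ∧ β ≤ β' ∧ ∀ K : ℕ, ∃ g₀ : ℝ,
        RunHyp S ⟨K, m, g₀⟩ ∧ Step.InInterval γ K (S.cpl ⟨K, m, g₀⟩) ∧ S.cpl ⟨K, m, g₀⟩ K = g ∧
          Step.Discrete031 (β * Real.log S.L) (β' * Real.log S.L) K g (S.cpl ⟨K, m, g₀⟩) := by
  obtain ⟨γ₀, hγ₀, hγ⟩ := tunedRuns_of_theorem2Statement h m
  -- a radius below γ₀, γu, S.γ and 1∕√(|b′| + 1)
  set γ₁ : ℝ := min (min γ₀ γu) (min S.γ (1 / Real.sqrt (|b'| + 1))) with hγ₁def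
  have hB : 0 < |b'| + 1 := by positivity
  have hr : 0 < 1 / Real.sqrt (|b'| + 1) := by positivity
  have hγ₁ : 0 < γ₁ := lt_min (lt_min hγ₀ hγu) (lt_min hSγ hr)
  refine ⟨γ₁, hγ₁, fun γ hγpos hγle => ?_⟩
  have hγ0 : γ ≤ γ₀ := hγle.trans ((min_le_left _ _).trans (min_le_left _ _))
  have hγu' : γ ≤ γu := hγle.trans ((min_le_left _ _).trans (min_le_right _ _))
  have hγS : γ ≤ S.γ := hγle.trans ((min_le_right _ _).trans (min_le_left _ _))
  have hγr : γ ≤ 1 / Real.sqrt (|b'| + 1) := hγle.trans ((min_le_right _ _).trans (min_le_right _ _))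
  have hsmall : b' * γ ^ 2 < 1 := by
    have hsq : γ ^ 2 ≤ (1 / Real.sqrt (|b'| + 1)) ^ 2 := pow_le_pow_left₀ hγpos.le hγr 2
    rw [div_pow, one_pow, Real.sq_sqrt hB.le] at hsq
    have h1 : b' * γ ^ 2 ≤ |b'| * γ ^ 2 := mul_le_mul_of_nonneg_right (le_abs_self b') (by positivity)
    have h2 : |b'| * γ ^ 2 ≤ |b'| * (1 / (|b'| + 1)) := mul_le_mul_of_nonneg_left hsq (abs_nonneg b')
    have h3 : |b'| * (1 / (|b'| + 1)) < 1 := by rw [mul_one_div, div_lt_one hB]; linarith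
    linarith
  have hupγ : BetaUpperH b' γ S.β := betaUpperH_mono hup hγu'
  have hrgγ := hrg_of_betaUpperH hD hγpos hupγ hsmall
  obtain ⟨g₁, hg₁, hg⟩ := hγ γ hγpos hγ0
  refine ⟨g₁, hg₁, fun g hgpos hgle => ?_⟩
  obtain ⟨β, β', hβ, hββ', hK⟩ := hg g hgpos hgle
  refine ⟨β, β', hβ, hββ', fun K => ?_⟩
  obtain ⟨g₀, hI, hend, hD031⟩ := hK K
  have hI' : Step.InInterval S.γ K (S.cpl ⟨K, m, g₀⟩) := fun k hk => ⟨(hI k hk).1, (hI k hk).2.trans hγS⟩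
  exact ⟨g₀, ⟨hrgγ ⟨K, m, g₀⟩ hI, hI'⟩, hI, hend, hD031⟩

/-- **… and with Theorem 3's printed `Conclusions`: print's bound along the tuned family and the rate condition β·ln L ≤ β′₅₁₀**, from
Theorem 2 + (U) + `Definitions ∧ Conclusions` — `…B12AsPrintedTuned.theorem2_rate_le_betaPrime510` with `hrg` discharged by (U).
[cite: Balaban1987RG1, Thm 2 (0.31) p.259 with (5.10) p.293, (5.42) p.297 and Thm 3 p.264] -/
theorem theorem2_rate_le_betaPrime510_of_upper {hL : Odd S.L ∧ 1 < S.L} (h : Theorem2Statement S hL) (hD : Definitions S)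
    (hC : Conclusions S) {b' γu : ℝ} (hγu : 0 < γu) (hup : BetaUpperH b' γu S.β) (hSγ : 0 < S.γ) (m : ℕ) :
    ∃ γ₁ : ℝ, 0 < γ₁ ∧ ∀ γ : ℝ, 0 < γ → γ ≤ γ₁ → ∃ g₁ : ℝ, 0 < g₁ ∧ ∀ g : ℝ, 0 < g → g ≤ g₁ →
      ∃ β β' : ℝ, 0 < β ∧ β ≤ β' ∧ β * Real.log S.L ≤ betaPrime510 4 (S.C510 * S.E₀) S.δ₁ ∧ ∀ K : ℕ, ∃ g₀ : ℝ,
        RunHyp S ⟨K, m, g₀⟩ ∧ S.cpl ⟨K, m, g₀⟩ K = g ∧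
          (∀ j, j + 1 ≤ K → |S.β j (prefixOf (S.cpl ⟨K, m, g₀⟩) j)| ≤ betaPrime510 4 (S.C510 * S.E₀) S.δ₁) ∧
          Step.Discrete031 (β * Real.log S.L) (min (β' * Real.log S.L) (betaPrime510 4 (S.C510 * S.E₀) S.δ₁)) K g
            (S.cpl ⟨K, m, g₀⟩) := by
  obtain ⟨γ₁, hγ₁, hγ⟩ := runHyp_of_theorem2Statement_of_upper h hD hγu hup hSγ m
  refine ⟨γ₁, hγ₁, fun γ hγpos hγle => ?_⟩
  obtain ⟨g₁, hg₁, hg⟩ := hγ γ hγpos hγle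
  refine ⟨g₁, hg₁, fun g hgpos hgle => ?_⟩
  obtain ⟨β, β', hβ, hββ', hK⟩ := hg g hgpos hgle
  have hlog : 0 < Real.log (S.L : ℝ) := Real.log_pos (by exact_mod_cast hL.2)
  have both : ∀ K, ∃ g₀ : ℝ, RunHyp S ⟨K, m, g₀⟩ ∧ S.cpl ⟨K, m, g₀⟩ K = g ∧
      Step.Discrete031 (β * Real.log S.L) (β' * Real.log S.L) K g (S.cpl ⟨K, m, g₀⟩) ∧
      Step.Discrete031 (-betaPrime510 4 (S.C510 * S.E₀) S.δ₁) (betaPrime510 4 (S.C510 * S.E₀) S.δ₁) K g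
        (S.cpl ⟨K, m, g₀⟩) := fun K => by
    obtain ⟨g₀, hR, -, hend, hD031⟩ := hK K
    have hP := discrete031_abs_of_conclusions hD hC hR
    rw [show (⟨K, m, g₀⟩ : B12.RunParams).K = K from rfl, hend] at hP
    exact ⟨g₀, hR, hend, hD031, hP⟩
  have hrate : β * Real.log S.L ≤ betaPrime510 4 (S.C510 * S.E₀) S.δ₁ := by
    obtain ⟨g₀, -, -, h1, h2⟩ := both 1
    exact lower_le_upper_of_discrete031 le_rfl h1 h2
  refine ⟨β, β', hβ, hββ', hrate, fun K => ?_⟩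
  obtain ⟨g₀, hR, hend, h1, h2⟩ := both K
  refine ⟨g₀, hR, hend, fun j hj => ?_, ?_⟩
  · exact Summit.QuantumFields.BalabanUV.Beta.B12AsPrintedRowD4Junction.abs_beta_prefix_le_betaPrime510 hD hC hR hj
  · have hc := discrete031_combine h1 h2
    have hmax : max (β * Real.log S.L) (-betaPrime510 4 (S.C510 * S.E₀) S.δ₁) = β * Real.log S.L :=
      max_eq_left (by linarith [mul_pos hβ hlog, hrate.trans' (mul_pos hβ hlog).le])
    rw [hmax] at hc
    exact hc

/-- **FROM THE THREE LETTERS ALONE (no Theorem-2 hypothesis): Theorem 2's statement AND Theorem 3's run hypothesis along the tuned family.**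
`StandingHypotheses ∧ Definitions` + joint continuity + `0 < b ≤ β_{k+1} ≤ b′` on the boxes ]0, γ₀]^{k+1} ⟹ for every m: tuned runs with
`RunHyp`, g_K = g and (0.31) — `theorem2Statement_of_letters` (forward shooting) followed by `runHyp_of_theorem2Statement_of_upper` (the
same upper letter discharges `hrg`).  So under the β sub-cell's box letters the interface's Theorem-3 `Conclusions` become available along the
tuned family with no further binder. [cite: Balaban1987RG1, Thm 2 (0.31) p.259, Thm 3 p.264; Balaban1989LargeFieldII, p.355] -/
theorem runHyp_of_letters (hH : StandingHypotheses S) (hD : Definitions S) {γ₀ b b' : ℝ} (hγ₀ : 0 < γ₀) (hb : 0 < b)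
    (hbb' : b ≤ b') (hcont : BetaContH γ₀ S.β) (hlo : BetaLowerH b γ₀ S.β) (hup : BetaUpperH b' γ₀ S.β) (m : ℕ) :
    ∃ γ₁ : ℝ, 0 < γ₁ ∧ ∀ γ : ℝ, 0 < γ → γ ≤ γ₁ → ∃ g₁ : ℝ, 0 < g₁ ∧ ∀ g : ℝ, 0 < g → g ≤ g₁ →
      ∃ β β' : ℝ, 0 < β ∧ β ≤ β' ∧ ∀ K : ℕ, ∃ g₀ : ℝ,
        RunHyp S ⟨K, m, g₀⟩ ∧ Step.InInterval γ K (S.cpl ⟨K, m, g₀⟩) ∧ S.cpl ⟨K, m, g₀⟩ K = g ∧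
          Step.Discrete031 (β * Real.log S.L) (β' * Real.log S.L) K g (S.cpl ⟨K, m, g₀⟩) :=
  runHyp_of_theorem2Statement_of_upper (theorem2Statement_of_letters hH hD hγ₀ hb hbb' hcont hlo hup) hD hγ₀ hup hH.hγ m

end

end Summit.QuantumFields.BalabanUV.Beta.EriceFlowEnclosureB12AsPrintedTunedUpper
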